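import Literature.AlgebraicGeometry.HodgeTheory.HodgeCommutantAbelianOfProducts
import HarnessLib

/-!
# `T × E³`, `T` a threefold of unitary type `(2,1)` over `End⁰(T) = ℚ(√-d)`, `E` an elliptic curve with complex
# multiplication: `B²(T × E³) ⊆ D² + α₁^* B²(T × E) + α₂^* B²(T × E) + α₃^* B²(T × E)`
# (Moonen–Zarhin 1999 Thm. 0.2 (1), cases (a)/(e) carried to the SIXFOLD `E³ × T`; §5 (5.3), (5.12))

Family `hodge`, layer `Literature/AlgebraicGeometry/HodgeTheory`. Written for the cell `pub-hodgeav-hg6` (LADDER-HodgeAV row 2,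
TABLE X (dimension 6) row 21 `g6.E3xY3.(2,1)` = `E_k³ × Y₃/k (2,1)`; census programme γ2, brick γ2-B, eng-2 g6; honest framing of
that cell: HC / HC_AV / HC_CM NOT proved — THIS file is UNCONDITIONAL: no named fact, no HC_CM, no Weil-class input).
Theorems only (no definition, D-0026; nothing admitted). It is the VERBATIM port `E × E ↦ (E × E) × E` of §5 of the tree's
`UnitaryTwoOneTimesCMCurveSquareCodimTwo` (programme R41: Moonen–Zarhin's case (e), the FIVEFOLD `T × E²`), whose ingredients are
general in the second factor `S`: the invariance theorem
`AVSlots.exists_coeff_eq_zero_off_balanced_or_onePerPair_of_prod_unitaryTwoOne_abelianCommutant` (one slot over `T × S`, `S` any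
abelian variety with abelian Hodge-commutant; Lie step `Motives/HodgeThetaAnnihilatorUnitaryTimesAbelianCommutant`, «`Hg(X) ⊃ {1} ×
SU_k(V_T)`») and the typed-Künneth criterion; the new input for `S = E³` is `hSc_cmCurve_powSucc`
(`HodgeCommutantAbelianOfProducts`: the Hodge-commutant of `H¹(E³)` is commutative).

PRINTED RESULT it extends (B. Moonen, Yu. Zarhin, Math. Ann. 315 (1999), Thm. 0.2 (1) [held `paper:arxiv-math_9901113` p0001]:
for `X ∼ X₁² × X₂`, `X₁` a CM elliptic curve over `k`, `X₂` a simple `(2,1)`-threefold with `k ↪ End⁰(X₂)`: «the Hodge ring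
`B•(X)` is generated by the subalgebra `D•(X)` of divisor classes together with the subspaces `W_{k,α}`, where `α` runs through
the set of surjective homomorphisms `X → X₁ × X₂`»; Thm. 0.2 (1)–(4) read in codimension two: `B² = D² + Σ_α α^* B²(X')` over fourfold quotients — MZ99 has no item (2.8), §2 ends with Thm. (2.7)) — the same
mechanism one dimension up, for `X = X₁³ × X₂` (a sixfold, outside MZ99's `dim ≤ 5`; the atlas's «S-W4 for B²: pull-backs of
`W_k(E_k × Y₃)`», TABLE-X-g6-v0 §1 row 21), in CODIMENSION TWO:

* **`mem_divisorClassesSpan_sup_span_pullbacks_of_unitaryTwoOne_cmCurve_cube`** — for `T` (here `Y`) a complex abelian threefold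
  with `dim_ℚ End⁰(T) = 2`, `φ ≫ φ = -d` (`d > 0`) of multiplicity `1` at `i√d` or at `-i√d`, and `E` an elliptic curve with
  `χ ≫ χ = -d'` (`d' > 0`; ANY imaginary quadratic `ℚ(χ)`): every rational `(2,2)`-class on `T × ((E × E) × E)` lies in
  `D² + Σ_{a=1}^{3} α_a^* B²(T × E)`, `α_a = 𝟙 × q_a` for the three projections `q₁ = pr₁₂ ≫ pr₁`, `q₂ = pr₁₂ ≫ pr₂`,
  `q₃ = pr₃`.  PROOF (R41 §5 verbatim with three summands): the invariance theorem splits the letter expansion of `c` into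
  `c_B` (T-kind-balanced words) and `c_W` (one letter from each `T`-pair, hence exactly ONE `S`-letter): `c_W` is the Künneth
  component of `S`-degree `1` — RATIONAL (`complexBetti_kunneth_bijective`, `isRationalClass_kunneth_symm_apply`) and of type
  `(2,2)` — and `c_W = Σ_a α_a^*(σ_a^* c_W)` for the sections `σ_a = 𝟙 × ι_a` because `Σ_a q_a ≫ ι_a = 𝟙_{E³}` and `H¹` pull-backs
  are additive in the homomorphism; `c_B = c − c_W` is a rational `(2,2)`-class in the span of typed products, hence a combination
  of products of rational Hodge classes of `T` and of `E³` (`mem_span_hodgeProductClasses_of_mem_span_pureType`), which are divisor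
  classes (`dim T = dim E³ = 3`, `isDivisorGenerated_of_dim_le_three`).
NOT asserted: that the three pull-backs are Weil classes, `D² ≠ B²`, anything in codimension `3` (brick γ2-D), any algebraicity.

## References
* [MoonenZarhin1999LowDim] B. Moonen, Yu. Zarhin, Math. Ann. 315 (1999), Thm. 0.2 (1) with cases (a), (e), Thm. 0.2 (1)–(4), §5 (5.3), (5.12) (arXiv v2 = Math. Ann. numbering: the case (e) Hodge-ring computation is (5.12); earlier tree copies wrote «(5.11)» and a non-existent «(2.8)»).
* [vanGeemen1994HodgeAV] B. van Geemen, LNM 1594 (1994), 3.6–3.7, 4.9.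
* [HatcherAT2002] A. Hatcher, *Algebraic Topology*, §3.2 Prop. 3.10, Thm. 3.16.
* [Lange2023AbelianVarietiesC] H. Lange, *Abelian Varieties over the Complex Numbers* (2023), Cor. 2.4.26.
-/

noncomputable section

open scoped TensorProduct
open CategoryTheory Module

namespace Literature.AlgebraicGeometry.HodgeTheory

open Literature.AlgebraicTopology.SingularHomology
open Literature.AlgebraicGeometry.Motives (IsSmoothProjective AbelianVariety bettiCohomology
  ofRatClassBaseChange ofRatClassBaseChange_tmul HodgeTensorFacts hodgeTensorFacts_holds ComplexPoints)
open Literature.Barriers.HodgeConjecture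
open Literature.AlgebraicGeometry.Motives.HodgeStructure
open Literature.AlgebraicGeometry.ComplexMultiplication
open Literature.RepresentationTheory.GeneralLinear
open Literature.NumberTheory.DiophantineGeometry

/-! ### §1 Künneth degrees (copies of the private lemmas of R41 §4) -/

section KunnethDegree

variable {hA h dd : ℕ}

/-- The two elements of `Fin 2`. [folklore] -/
private theorem fin2_eq_zero_or_one_cu (r : Fin 2) : r = 0 ∨ r = 1 := by
  fin_cases r <;> simp

/-- The two cardinalities of a left/right split add up to the number of positions. [folklore] -/
private theorem card_isLeft_add_card_not_isLeft_cu {T P : Type*} (col : Fin dd → T ⊕ P) :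
    Fintype.card {t // (col t).isLeft = true} + Fintype.card {t // ¬ (col t).isLeft = true} = dd := by
  classical
  rw [Fintype.card_subtype_compl, Nat.add_sub_cancel' (Fintype.card_subtype_le _), Fintype.card_fin]

/-- A `T`-kind-balanced word has an EVEN number of `T`-positions. [folklore] -/
private theorem even_card_isLeft_of_balanced_cu (P : Fin dd → Fin hA ⊕ Fin h) (η : Fin dd → Fin 2)
    (hbal : ∑ t, Sum.elim (fun _ : Fin hA => if η t = 0 then (1 : ℤ) else -1) (fun _ : Fin h => (0 : ℤ)) (P t) = 0) :
    Even (Fintype.card {t // (P t).isLeft = true}) := by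
  classical
  set A0 := (Finset.univ.filter fun t => (P t).isLeft = true ∧ η t = 0).card with hA0
  set A1 := (Finset.univ.filter fun t => (P t).isLeft = true ∧ η t = 1).card with hA1
  have hsum : ∑ t, Sum.elim (fun _ : Fin hA => if η t = 0 then (1 : ℤ) else -1) (fun _ : Fin h => (0 : ℤ)) (P t) =
      (A0 : ℤ) - (A1 : ℤ) := by
    rw [hA0, hA1, Finset.card_filter, Finset.card_filter, Nat.cast_sum, Nat.cast_sum, ← Finset.sum_sub_distrib]
    refine Finset.sum_congr rfl fun t _ => ?_
    rcases hP : P t with ℓ | e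
    · rcases Fin.exists_fin_two.1 ⟨η t, rfl⟩ with h0 | h0 <;> simp [h0]
    · simp
  have hcard : Fintype.card {t // (P t).isLeft = true} = A0 + A1 := by
    rw [Fintype.card_subtype, hA0, hA1,
      ← Finset.card_filter_add_card_filter_not (s := Finset.univ.filter fun t => (P t).isLeft = true)
        (fun t => η t = 0), Finset.filter_filter, Finset.filter_filter]
    congr 2
    refine Finset.filter_congr fun t _ => ?_
    rcases Fin.exists_fin_two.1 ⟨η t, rfl⟩ with h0 | h0 <;> simp [h0]
  rw [hsum] at hbal
  have hA01 : A0 = A1 := by omega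
  exact ⟨A0, by rw [hcard, hA01]⟩

end KunnethDegree

/-! ### §2 `B²(T × E³) ⊆ D² + Σ_a α_a^* B²(T × E)` -/

section CodimTwo

open MonoidalCategory CartesianMonoidalCategory

variable {Y E : AbelianVariety ℂ}

/-- Pull-back of an exterior product `pr_Y^* u ⌣ pr_S^* v` along an endomorphism `θ` of `Y × S` over `Y` covering
`e : S → S` (`θ ≫ pr_Y = pr_Y`, `θ ≫ pr_S = pr_S ≫ e`): `θ^*(pr_Y^* u ⌣ pr_S^* v) = pr_Y^* u ⌣ pr_S^* (e^* v)`.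
[cite: HatcherAT2002, §3.2 Prop. 3.10] -/
private theorem map_cupProduct_fst_snd_of_over_cu {Y S : AbelianVariety ℂ} {θ : Y.prod S ⟶ Y.prod S} {e : S ⟶ S}
    (hf : θ ≫ Motives.AbelianVariety.fst Y S = Motives.AbelianVariety.fst Y S)
    (hs : θ ≫ Motives.AbelianVariety.snd Y S = Motives.AbelianVariety.snd Y S ≫ e) {m r n : ℕ} (hmr : m + r = n)
    (u : complexBetti Y.X m) (v : complexBetti S.X r) :
    complexBetti.map θ.hom.hom.hom n (cupProduct hmr (complexBetti.map (Motives.AbelianVariety.fst Y S).hom.hom.hom m u)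
      (complexBetti.map (Motives.AbelianVariety.snd Y S).hom.hom.hom r v)) =
      cupProduct hmr (complexBetti.map (Motives.AbelianVariety.fst Y S).hom.hom.hom m u)
        (complexBetti.map (Motives.AbelianVariety.snd Y S).hom.hom.hom r (complexBetti.map e.hom.hom.hom r v)) := by
  have hmap : complexBetti.map θ.hom.hom.hom n (cupProduct hmr
      (complexBetti.map (Motives.AbelianVariety.fst Y S).hom.hom.hom m u)
      (complexBetti.map (Motives.AbelianVariety.snd Y S).hom.hom.hom r v)) =
      cupProduct hmr (complexBetti.map θ.hom.hom.hom m (complexBetti.map (Motives.AbelianVariety.fst Y S).hom.hom.hom m u))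
        (complexBetti.map θ.hom.hom.hom r (complexBetti.map (Motives.AbelianVariety.snd Y S).hom.hom.hom r v)) :=
    cupProduct_map _ hmr _ _
  rw [hmap, ← Milne1999.complexBetti_map_comp_apply, ← Milne1999.complexBetti_map_comp_apply, hf, hs,
    Milne1999.complexBetti_map_comp_apply]

/-- **Künneth components of `S`-degree one are sums of THREE pull-backs**: for `θ₁, θ₂, θ₃` over `Y` covering
`e₁, e₂, e₃` with `e₁ + e₂ + e₃ = 𝟙 S`, `θ₁^* x + θ₂^* x + θ₃^* x = x` on every `x = pr_Y^* u ⌣ pr_S^* v` with `v ∈ H¹(S)`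
(additivity of `H¹` pull-backs in the homomorphism). [cite: HatcherAT2002, §3.2 Thm. 3.16] [cite: LangeBirkenhake1992, §1.1 (p. 19)] -/
private theorem map_add_map_add_map_cupProduct_fst_snd_one_cu {Y S : AbelianVariety ℂ} {θ₁ θ₂ θ₃ : Y.prod S ⟶ Y.prod S}
    {e₁ e₂ e₃ : S ⟶ S}
    (h₁f : θ₁ ≫ Motives.AbelianVariety.fst Y S = Motives.AbelianVariety.fst Y S)
    (h₁s : θ₁ ≫ Motives.AbelianVariety.snd Y S = Motives.AbelianVariety.snd Y S ≫ e₁)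
    (h₂f : θ₂ ≫ Motives.AbelianVariety.fst Y S = Motives.AbelianVariety.fst Y S)
    (h₂s : θ₂ ≫ Motives.AbelianVariety.snd Y S = Motives.AbelianVariety.snd Y S ≫ e₂)
    (h₃f : θ₃ ≫ Motives.AbelianVariety.fst Y S = Motives.AbelianVariety.fst Y S)
    (h₃s : θ₃ ≫ Motives.AbelianVariety.snd Y S = Motives.AbelianVariety.snd Y S ≫ e₃) (he : e₁ + e₂ + e₃ = 𝟙 S)
    {m n : ℕ} (hmr : m + 1 = n) (u : complexBetti Y.X m) (v : complexBetti S.X 1) :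
    complexBetti.map θ₁.hom.hom.hom n (cupProduct hmr (complexBetti.map (Motives.AbelianVariety.fst Y S).hom.hom.hom m u)
      (complexBetti.map (Motives.AbelianVariety.snd Y S).hom.hom.hom 1 v)) +
    complexBetti.map θ₂.hom.hom.hom n (cupProduct hmr (complexBetti.map (Motives.AbelianVariety.fst Y S).hom.hom.hom m u)
      (complexBetti.map (Motives.AbelianVariety.snd Y S).hom.hom.hom 1 v)) +
    complexBetti.map θ₃.hom.hom.hom n (cupProduct hmr (complexBetti.map (Motives.AbelianVariety.fst Y S).hom.hom.hom m u)
      (complexBetti.map (Motives.AbelianVariety.snd Y S).hom.hom.hom 1 v)) =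
      cupProduct hmr (complexBetti.map (Motives.AbelianVariety.fst Y S).hom.hom.hom m u)
        (complexBetti.map (Motives.AbelianVariety.snd Y S).hom.hom.hom 1 v) := by
  rw [map_cupProduct_fst_snd_of_over_cu h₁f h₁s, map_cupProduct_fst_snd_of_over_cu h₂f h₂s,
    map_cupProduct_fst_snd_of_over_cu h₃f h₃s, ← map_add, ← map_add, ← map_add, ← map_add]
  congr 2
  have h12 := congrArg (fun F : complexBetti S.X 1 ⟶ complexBetti S.X 1 => F v) (complexBetti_map_add_one (e₁ + e₂) e₃)
  have h1 := congrArg (fun F : complexBetti S.X 1 ⟶ complexBetti S.X 1 => F v) (complexBetti_map_add_one e₁ e₂)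
  simp only [ModuleCat.hom_add, LinearMap.add_apply] at h12 h1
  rw [he] at h12
  change complexBetti.map (𝟙 S.X) 1 v = _ at h12
  rw [complexBetti.map_id] at h12
  rw [← h1]
  exact h12.symm

set_option maxHeartbeats 1600000 in
open scoped Classical in
/-- **`B²(T × E³) ⊆ D²(T × E³) + α₁^* B²(T × E) + α₂^* B²(T × E) + α₃^* B²(T × E)`, `α_a = 𝟙 × q_a` — Moonen–Zarhin's
Thm. 0.2 (1) mechanism for the SIXFOLD `E³ × T` (TABLE X row 21), codimension two, a THEOREM.** Let `T` (here `Y`) be a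
complex abelian threefold with `dim_ℚ End⁰(T) = 2`, `φ ≫ φ = -d` (`d > 0`) of multiplicity `1` at `i√d` or at `-i√d`
(`End⁰(T) = ℚ(√-d)` acting with multiplicities `(2,1)`), and `E` an elliptic curve with complex multiplication
`χ ≫ χ = -d'` (`d' > 0`; ANY imaginary quadratic `ℚ(χ)`). Then every rational `(2,2)`-class on `T × ((E × E) × E)` is a
`ℂ`-combination of products of divisor classes and of pull-backs of rational `(2,2)`-classes of the FOURFOLDS `T × E` along
the three surjections `α_a = 𝟙 × q_a`, `q₁ = pr₁₂ ≫ pr₁`, `q₂ = pr₁₂ ≫ pr₂`, `q₃ = pr₃ : (E × E) × E → E`.  Proof: R41 §5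
verbatim (invariance theorem for one slot over `T × S`, `S = (E × E) × E`, fed with `hSc_cmCurve_powSucc … 2`; the one-per-pair
words are the Künneth component of `S`-degree `1`, rational of type `(2,2)`, equal to `Σ_a α_a^*(σ_a^*(·))` by
`Σ_a q_a ≫ ι_a = 𝟙` and additivity of `H¹` pull-backs; the balanced words give products of rational Hodge classes of `T` and of
`E³`, i.e. divisor classes in dimensions `≤ 3`). NOT asserted: that the pull-backs are Weil classes `W_{k,α_a}`, nor `D² ≠ B²`.
[cite: MoonenZarhin1999LowDim, Thm. 0.2 (1) with cases (a), (e) and §5 (5.3), (5.12)] [cite: MoonenZarhin1999LowDim, Thm. 0.2 (1)–(4)]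
[cite: vanGeemen1994HodgeAV, 4.9] [cite: HatcherAT2002, §3.2 Thm. 3.16] -/
theorem mem_divisorClassesSpan_sup_span_pullbacks_of_unitaryTwoOne_cmCurve_cube (hY3 : Y.dim = 3)
    (hY2 : Module.finrank ℚ Y.endAlgebra = 2) (φY : Y ⟶ Y) {d : ℕ} (hd : 0 < d) (hφY : φY ≫ φY = -(d • 𝟙 Y))
    (hm1 : eigenMultiplicity Y φY (Complex.I * (Real.sqrt d : ℂ)) = 1 ∨
      eigenMultiplicity Y φY (-(Complex.I * (Real.sqrt d : ℂ))) = 1)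
    (hE1 : E.dim = 1) (χ : E ⟶ E) {d' : ℕ} (hd' : 0 < d') (hχ : χ ≫ χ = -(d' • 𝟙 E))
    {c : complexBetti (Y.prod ((E.prod E).prod E)).X (2 * 2)} (hcQ : IsRationalClass c)
    (hc : IsOfHodgeType (Y.prod ((E.prod E).prod E)).dim (Y.prod ((E.prod E).prod E)).X (2 * 2) 2 2 c) :
    c ∈ divisorClassesSpan (Y.prod ((E.prod E).prod E)).X (Y.prod ((E.prod E).prod E)).dim 2 ⊔
      Submodule.span ℂ {w' : complexBetti (Y.prod ((E.prod E).prod E)).X (2 * 2) |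
        ∃ (q : (E.prod E).prod E ⟶ E) (w : complexBetti (Y.prod E).X (2 * 2)),
          (q = Motives.AbelianVariety.fst (E.prod E) E ≫ Motives.AbelianVariety.fst E E ∨
            q = Motives.AbelianVariety.fst (E.prod E) E ≫ Motives.AbelianVariety.snd E E ∨
            q = Motives.AbelianVariety.snd (E.prod E) E) ∧
          IsRationalClass w ∧ IsOfHodgeType (Y.prod E).dim (Y.prod E).X (2 * 2) 2 2 w ∧
          w' = complexBetti.map (Motives.AbelianVariety.prodMap (𝟙 Y) q).hom.hom.hom (2 * 2) w} := by
  classical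
  -- `S = (E × E) × E = E.powSucc 2`
  have hS3 : ((E.prod E).prod E).dim = 3 := by
    rw [Motives.AbelianVariety.dim_prod, Motives.AbelianVariety.dim_prod, hE1]
  have hXP : IsSmoothProjective (Y.prod ((E.prod E).prod E)).dim (Y.prod ((E.prod E).prod E)).X :=
    AbelianVariety.isSmoothProjective_holds
  have hYs : IsSmoothProjective Y.dim Y.X := AbelianVariety.isSmoothProjective_holds
  have hSs : IsSmoothProjective ((E.prod E).prod E).dim ((E.prod E).prod E).X := AbelianVariety.isSmoothProjective_holds
  have hXE : IsSmoothProjective (Y.prod E).dim (Y.prod E).X := AbelianVariety.isSmoothProjective_holds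
  -- the invariance theorem, for `T × S` itself (one slot), `hSc` for `S = E.powSucc 2 = (E × E) × E`
  obtain ⟨hA, bA, h, cC, hbA0, hbA1, hcC0, hcC1, hmain⟩ :=
    (avSlots_self (Y.prod ((E.prod E).prod E))).exists_coeff_eq_zero_off_balanced_or_onePerPair_of_prod_unitaryTwoOne_abelianCommutant
      hY3 hY2 φY hd hφY hm1 (hSc_cmCurve_powSucc hE1 χ hd' hχ 2)
  obtain ⟨a, hca, hsupp⟩ := hmain two_pos hcQ hc
  have hA3 : hA = 3 := by
    haveI : Module.Finite ℚ (bettiCohomology Y.X 1) := finite_bettiCohomology_one Y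
    have hcard := Module.finrank_eq_card_basis bA
    rw [Module.finrank_baseChange, finrank_bettiCohomology_one Y, hY3, Fintype.card_prod, Fintype.card_fin,
      Fintype.card_fin] at hcard
    omega
  -- the letters, freed of the identity slot
  set xA : (Fin 1 × Fin hA) × Fin 2 → complexBetti Y.X 1 := fun jr =>
    ofRatClassBaseChange (Motives.ComplexPoints Y.X) 1 (bA (jr.1.2, jr.2)) with hxA
  set y : (Fin 1 × Fin h) × Fin 2 → complexBetti ((E.prod E).prod E).X 1 := fun jr =>
    ofRatClassBaseChange (Motives.ComplexPoints ((E.prod E).prod E).X) 1 (cC (jr.1.2, jr.2)) with hy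
  set L : (Fin 1 × (Fin hA ⊕ Fin h)) × Fin 2 → complexBetti (Y.prod ((E.prod E).prod E)).X 1 := fun jr => Sum.elim
    (fun i => complexBetti.map (Motives.AbelianVariety.fst Y ((E.prod E).prod E)).hom.hom.hom 1 (xA ((jr.1.1, i), jr.2)))
    (fun i => complexBetti.map (Motives.AbelianVariety.snd Y ((E.prod E).prod E)).hom.hom.hom 1 (y ((jr.1.1, i), jr.2)))
    jr.1.2 with hL
  have hletters : (fun jr : (Fin 1 × (Fin hA ⊕ Fin h)) × Fin 2 =>
      complexBetti.map ((![𝟙 (Y.prod ((E.prod E).prod E))]) jr.1.1).hom.hom.hom 1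
      (Sum.elim
        (fun i => complexBetti.map (Motives.AbelianVariety.fst Y ((E.prod E).prod E)).hom.hom.hom 1
          (ofRatClassBaseChange (Motives.ComplexPoints Y.X) 1 (bA (i, jr.2))))
        (fun i => complexBetti.map (Motives.AbelianVariety.snd Y ((E.prod E).prod E)).hom.hom.hom 1
          (ofRatClassBaseChange (Motives.ComplexPoints ((E.prod E).prod E).X) 1 (cC (i, jr.2))))
        jr.1.2)) = L := by
    funext jr
    obtain ⟨⟨j, t⟩, r⟩ := jr
    have hj : j = 0 := Subsingleton.elim _ _
    subst hj
    change complexBetti.map (𝟙 (Y.prod ((E.prod E).prod E)).X) 1 _ = _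
    rw [complexBetti.map_id]
    rcases t with i | i <;> rfl
  rw [hletters] at hca
  -- Hodge types of the letters
  have hL0 : ∀ jr : (Fin 1 × (Fin hA ⊕ Fin h)) × Fin 2, jr.2 = 0 →
      IsOfHodgeType (Y.prod ((E.prod E).prod E)).dim (Y.prod ((E.prod E).prod E)).X 1 1 0 (L jr) := by
    rintro ⟨⟨j, t⟩, r⟩ hr
    change r = 0 at hr
    subst hr
    rcases t with i | i
    · exact (hbA0 i).map_of_isSmoothProjective hXP hYs _
    · exact (hcC0 i).map_of_isSmoothProjective hXP hSs _
  have hL1 : ∀ jr : (Fin 1 × (Fin hA ⊕ Fin h)) × Fin 2, jr.2 = 1 →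
      IsOfHodgeType (Y.prod ((E.prod E).prod E)).dim (Y.prod ((E.prod E).prod E)).X 1 0 1 (L jr) := by
    rintro ⟨⟨j, t⟩, r⟩ hr
    change r = 1 at hr
    subst hr
    rcases t with i | i
    · exact (hbA1 i).map_of_isSmoothProjective hXP hYs _
    · exact (hcC1 i).map_of_isSmoothProjective hXP hSs _
  -- `T`-balanced words and the others
  let BAL : (Fin (2 * 2) → (Fin 1 × (Fin hA ⊕ Fin h)) × Fin 2) → Prop := fun w =>
    ∑ t, Sum.elim (fun _ : Fin hA => if (w t).2 = 0 then (1 : ℤ) else -1) (fun _ : Fin h => (0 : ℤ)) (w t).1.2 = 0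
  set aW : (Fin (2 * 2) → (Fin 1 × (Fin hA ⊕ Fin h)) × Fin 2) → ℂ := fun w => if BAL w then 0 else a w with haW
  set aB : (Fin (2 * 2) → (Fin 1 × (Fin hA ⊕ Fin h)) × Fin 2) → ℂ := fun w => if BAL w then a w else 0 with haB
  have hsplit : a = aB + aW := by
    funext w
    simp only [haB, haW, Pi.add_apply]
    split_ifs <;> simp
  set F := cupPowOneAlt ℂ (Motives.ComplexPoints (Y.prod ((E.prod E).prod E)).X) (2 * 2) with hF
  set cW := wordEval F L aW with hcW
  set cB := wordEval F L aB with hcB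
  have hc_eq : c = cB + cW := by rw [← hca, hsplit, map_add]
  -- the unbalanced words in the support: kind balanced, no repeated letter, exactly `3` `T`-positions
  have hsuppW : ∀ w : Fin (2 * 2) → (Fin 1 × (Fin hA ⊕ Fin h)) × Fin 2, ¬ BAL w → a w ≠ 0 →
      (∀ r : Fin 2, (Finset.univ.filter fun t => (w t).2 = r).card = 2) ∧
        Function.Injective (fun t => ((w t).1.2, (w t).2)) ∧
        Fintype.card {t // ((w t).1.2).isLeft = true} = 3 := by
    intro w hw hne
    obtain ⟨hcnt, hinj, hbal | hcard⟩ := hsupp (fun t => (w t).1) (fun t => (w t).2) (by simpa using hne)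
    · exact absurd hbal hw
    · exact ⟨hcnt, hinj, by rw [hcard, hA3]⟩
  -- (1) `c_W` is of type `(2,2)` (kind balance), hence so is `c_B = c - c_W`
  have hmono22 : ∀ w : Fin (2 * 2) → (Fin 1 × (Fin hA ⊕ Fin h)) × Fin 2, ¬ BAL w → a w ≠ 0 →
      IsOfHodgeType (Y.prod ((E.prod E).prod E)).dim (Y.prod ((E.prod E).prod E)).X (2 * 2) 2 2 (F (L ∘ w)) := by
    intro w hw hne
    obtain ⟨hcnt, -, -⟩ := hsuppW w hw hne
    have h22 := isOfHodgeType_cupPowOne_of_kinds L hL0 hL1 w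
    have e0 : (∑ t, if (w t).2 = 0 then 1 else 0 : ℕ) = 2 := by
      rw [← Finset.card_filter]; exact hcnt 0
    have e1 : (∑ t, if (w t).2 = 0 then 0 else 1 : ℕ) = 2 := by
      have h' : ∀ t, (if (w t).2 = 0 then 0 else 1 : ℕ) = if (w t).2 = 1 then 1 else 0 := fun t => by
        rcases fin2_eq_zero_or_one_cu (w t).2 with h0 | h0 <;> simp [h0]
      simp only [h']
      rw [← Finset.card_filter]; exact hcnt 1
    rw [e0, e1] at h22
    rw [hF, cupPowOneAlt_apply]
    exact h22
  have hcW22 : IsOfHodgeType (Y.prod ((E.prod E).prod E)).dim (Y.prod ((E.prod E).prod E)).X (2 * 2) 2 2 cW := by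
    rw [hcW, wordEval_apply]
    refine IsOfHodgeType.sum hXP (nonempty_hodgeModel_holds hXP).some _ _ fun w _ => ?_
    by_cases hw : BAL w
    · simp only [haW, if_pos hw, zero_smul]
      exact IsOfHodgeType.zero (nonempty_hodgeModel_holds hXP).some _ _ _
    · by_cases hne : a w = 0
      · simp only [haW, if_neg hw, hne, zero_smul]
        exact IsOfHodgeType.zero (nonempty_hodgeModel_holds hXP).some _ _ _
      · simp only [haW, if_neg hw]
        exact (hmono22 w hw hne).smul _
  have hcB22 : IsOfHodgeType (Y.prod ((E.prod E).prod E)).dim (Y.prod ((E.prod E).prod E)).X (2 * 2) 2 2 cB := by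
    have e : cB = c - cW := by rw [hc_eq, add_sub_cancel_right]
    rw [e]; exact hc.sub hXP hcW22
  -- (2) `c_B` lies in the span of the typed products
  have hcB_mem := wordEval_mem_span_typed_cup_pureType_of_eq_zero_off_balanced
    (Motives.AbelianVariety.fst Y ((E.prod E).prod E)) (Motives.AbelianVariety.snd Y ((E.prod E).prod E)) xA y
    (fun jr hjr => by obtain ⟨⟨j, i⟩, r⟩ := jr; change r = 0 at hjr; subst hjr; exact hbA0 i)
    (fun jr hjr => by obtain ⟨⟨j, i⟩, r⟩ := jr; change r = 1 at hjr; subst hjr; exact hbA1 i)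
    (fun jr hjr => by obtain ⟨⟨j, i⟩, r⟩ := jr; change r = 0 at hjr; subst hjr; exact hcC0 i)
    (fun jr hjr => by obtain ⟨⟨j, i⟩, r⟩ := jr; change r = 1 at hjr; subst hjr; exact hcC1 i)
    (p := 2) (a := aB) (fun U η hU => by
      by_cases hw : BAL (fun t => (U t, η t))
      · exfalso
        apply hU
        have hcast : ∀ t, Sum.elim (fun _ : Fin hA => if η t = 0 then (1 : ℂ) else -1) (fun _ : Fin h => (0 : ℂ))
            (U t).2 = ((Sum.elim (fun _ : Fin hA => if η t = 0 then (1 : ℤ) else -1) (fun _ : Fin h => (0 : ℤ))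
              (U t).2 : ℤ) : ℂ) := by
          intro t
          rcases (U t).2 with ℓ | e
          · simp only [Sum.elim_inl]; split_ifs <;> simp
          · simp
        have hw' : ∑ t, Sum.elim (fun _ : Fin hA => if η t = 0 then (1 : ℤ) else -1) (fun _ : Fin h => (0 : ℤ))
            (U t).2 = 0 := hw
        simp only [hcast]
        rw [← Int.cast_sum, hw', Int.cast_zero]
      · simp only [haB, if_neg hw])
  -- (3) RATIONALITY of `c_W`: it is the Künneth component of `c` of `S`-degree `1`
  have hb : ∀ j : Fin (2 * ((E.prod E).prod E).dim + 1), ∃ (r : ℕ) (b : Module.Basis (Fin r) ℂ (complexBetti ((E.prod E).prod E).X j)),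
      ∀ i, IsRationalClass (b i) := fun j => exists_basis_isRationalClass hSs j
  choose r b hbQ using hb
  have hbij : Function.Bijective (LerayHirsch.lhMap ℂ (fun J : (Σ j, Fin (r j)) => (J.1 : ℕ))
      (Motives.AlgPoints.mapContinuous (L := ℂ) (Motives.AbelianVariety.fst Y ((E.prod E).prod E)).hom.hom.hom)
      (fun J => complexBetti.map (Motives.AbelianVariety.snd Y ((E.prod E).prod E)).hom.hom.hom J.1 (b J.1 J.2)) (2 * 2)) :=
    complexBetti_kunneth_bijective hYs hSs b (2 * 2)
  set θ := LinearEquiv.ofBijective _ hbij with hθ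
  have hθsum : ∀ a' : (Fin (2 * 2) → (Fin 1 × (Fin hA ⊕ Fin h)) × Fin 2) → ℂ,
      θ.symm (∑ w, a' w • F (L ∘ w)) = ∑ w, θ.symm (a' w • F (L ∘ w)) := fun a' => map_sum θ.symm _ _
  have hθsmul : ∀ (s : ℂ) (x : complexBetti (Y.prod ((E.prod E).prod E)).X (2 * 2)), θ.symm (s • x) = s • θ.symm x :=
    fun s x => map_smul θ.symm s x
  have hθadd : ∀ x x' : complexBetti (Y.prod ((E.prod E).prod E)).X (2 * 2), θ.symm (x + x') = θ.symm x + θ.symm x' :=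
    fun x x' => map_add θ.symm x x'
  -- Künneth coefficients of `pr_T^* u ⌣ pr_S^* v` vanish off the `S`-degree of `v`
  have hvan : ∀ (m r' : ℕ) (hmr : m + r' = 2 * 2) (u : complexBetti Y.X m) (v : complexBetti ((E.prod E).prod E).X r')
      (J : LerayHirsch.Idx (fun J : (Σ j, Fin (r j)) => (J.1 : ℕ)) (2 * 2)), (J.1.1 : ℕ) ≠ r' →
      θ.symm (cupProduct hmr (complexBetti.map (Motives.AbelianVariety.fst Y ((E.prod E).prod E)).hom.hom.hom m u)
        (complexBetti.map (Motives.AbelianVariety.snd Y ((E.prod E).prod E)).hom.hom.hom r' v)) J = 0 := by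
    intro m r' hmr u v J hJ
    by_cases hr2 : r' ≤ 2 * ((E.prod E).prod E).dim
    · obtain rfl : m = 2 * 2 - r' := by omega
      have key : θ.symm (cupProduct hmr (complexBetti.map (Motives.AbelianVariety.fst Y ((E.prod E).prod E)).hom.hom.hom
          (2 * 2 - r') u) (complexBetti.map (Motives.AbelianVariety.snd Y ((E.prod E).prod E)).hom.hom.hom r' v)) = _ :=
        kunneth_symm_cupProduct_eq_sum hYs hSs b (2 * 2) (j := ⟨r', by omega⟩) (by change r' ≤ 2 * 2; omega) u v
      rw [key, Finset.sum_apply]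
      refine Finset.sum_eq_zero fun i _ => ?_
      rw [Pi.smul_apply, Pi.single_eq_of_ne, smul_zero]
      intro hJi
      apply hJ
      rw [hJi]
    · haveI := subsingleton_complexBetti hSs (lt_of_not_ge hr2)
      have hv : v = 0 := Subsingleton.elim _ _
      rw [hv, map_zero, map_zero]
      exact congrFun (map_zero θ.symm) J
  -- every word's monomial is `± pr_T^*(T-monomial) ⌣ pr_S^*(S-monomial)`, the `S`-degree being the number of
  -- `S`-positions
  have hterm : ∀ w : Fin (2 * 2) → (Fin 1 × (Fin hA ⊕ Fin h)) × Fin 2,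
      ∃ (m r' : ℕ) (hmr : m + r' = 2 * 2) (u : complexBetti Y.X m) (v : complexBetti ((E.prod E).prod E).X r') (s : ℂ),
        F (L ∘ w) = s • cupProduct hmr (complexBetti.map (Motives.AbelianVariety.fst Y ((E.prod E).prod E)).hom.hom.hom m u)
          (complexBetti.map (Motives.AbelianVariety.snd Y ((E.prod E).prod E)).hom.hom.hom r' v) ∧
        m = Fintype.card {t // ((w t).1.2).isLeft = true} ∧ r' = Fintype.card {t // ¬ ((w t).1.2).isLeft = true} := by
    intro w
    set col : Fin (2 * 2) → Fin hA ⊕ Fin h := fun t => (w t).1.2 with hcol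
    set m := Fintype.card {t // (col t).isLeft = true} with hm
    set r' := Fintype.card {t // ¬ (col t).isLeft = true} with hr'
    have hmr : m + r' = 2 * 2 := card_isLeft_add_card_not_isLeft_cu col
    obtain ⟨φ, τA, iC, hAcol, hCcol⟩ := exists_leftSplit col hm.symm hr'.symm
    set wA : Fin m → (Fin 1 × Fin hA) × Fin 2 := fun a' =>
      (((w (φ.symm (Sum.inl a'))).1.1, τA a'), (w (φ.symm (Sum.inl a'))).2) with hwA
    set wC : Fin r' → (Fin 1 × Fin h) × Fin 2 := fun b' =>
      (((w (φ.symm (Sum.inr b'))).1.1, iC b'), (w (φ.symm (Sum.inr b'))).2) with hwC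
    have hword : (L ∘ w) = fun t => Sum.elim
        (fun a' => complexBetti.map (Motives.AbelianVariety.fst Y ((E.prod E).prod E)).hom.hom.hom 1 (xA (wA a')))
        (fun b' => complexBetti.map (Motives.AbelianVariety.snd Y ((E.prod E).prod E)).hom.hom.hom 1 (y (wC b'))) (φ t) := by
      funext t
      obtain ⟨s, rfl⟩ := φ.symm.surjective t
      rw [Function.comp_apply, Equiv.apply_symm_apply]
      rcases s with a' | b'
      · have h1 : (w (φ.symm (Sum.inl a'))).1.2 = Sum.inl (τA a') := hAcol a'
        simp only [hL, h1, Sum.elim_inl, hwA]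
      · have h1 : (w (φ.symm (Sum.inr b'))).1.2 = Sum.inr (iC b') := hCcol b'
        simp only [hL, h1, Sum.elim_inr, hwC]
    refine ⟨m, r', hmr, cupPowOne ℂ (Motives.ComplexPoints Y.X) m (xA ∘ wA),
      cupPowOne ℂ (Motives.ComplexPoints ((E.prod E).prod E).X) r' (y ∘ wC),
      (((Equiv.Perm.sign (φ.trans (finSumFinEquiv.trans (finCongr hmr))) : ℤˣ) : ℤ) : ℂ), ?_, rfl, rfl⟩
    rw [hF, cupPowOneAlt_apply, hword, cupPowOne_sumElim_eq_sign_smul_cupProduct ℂ φ hmr,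
      ← Motives.complexBetti_map_cupPowOne, ← Motives.complexBetti_map_cupPowOne]
    rfl
  -- `S`-degrees: unbalanced words `1`, balanced words even (`≠ 1`)
  have hdegW : ∀ w : Fin (2 * 2) → (Fin 1 × (Fin hA ⊕ Fin h)) × Fin 2, ¬ BAL w → a w ≠ 0 →
      Fintype.card {t // ¬ ((w t).1.2).isLeft = true} = 1 := by
    intro w hw hne
    obtain ⟨-, -, h3⟩ := hsuppW w hw hne
    have hsum := card_isLeft_add_card_not_isLeft_cu (fun t => (w t).1.2)
    omega
  have hdegB : ∀ w : Fin (2 * 2) → (Fin 1 × (Fin hA ⊕ Fin h)) × Fin 2, BAL w → a w ≠ 0 →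
      Fintype.card {t // ¬ ((w t).1.2).isLeft = true} ≠ 1 := by
    intro w hw _
    have hw' : ∑ t, Sum.elim (fun _ : Fin hA => if (w t).2 = 0 then (1 : ℤ) else -1) (fun _ : Fin h => (0 : ℤ))
        (w t).1.2 = 0 := hw
    have hev := even_card_isLeft_of_balanced_cu (fun t => (w t).1.2) (fun t => (w t).2) hw'
    have hmr := card_isLeft_add_card_not_isLeft_cu (fun t => (w t).1.2)
    obtain ⟨k, hk⟩ := hev
    omega
  -- Künneth coefficients: `c_W` has only `S`-degree-`1` coefficients, `c_B` none
  have hθW : ∀ J : LerayHirsch.Idx (fun J : (Σ j, Fin (r j)) => (J.1 : ℕ)) (2 * 2), (J.1.1 : ℕ) ≠ 1 →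
      θ.symm cW J = 0 := by
    intro J hJ
    rw [hcW, wordEval_apply, hθsum, Finset.sum_apply]
    refine Finset.sum_eq_zero fun w _ => ?_
    rw [hθsmul, Pi.smul_apply]
    by_cases hw : BAL w
    · simp only [haW, if_pos hw, zero_smul]
    · by_cases hne : a w = 0
      · simp only [haW, if_neg hw, hne, zero_smul]
      · obtain ⟨m, r', hmr, u, v, s, hFw, -, hr'⟩ := hterm w
        have h1 : r' = 1 := by rw [hr']; exact hdegW w hw hne
        rw [hFw, hθsmul, Pi.smul_apply, hvan m r' hmr u v J (by rw [h1]; exact hJ), smul_zero, smul_zero]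
  have hθB : ∀ J : LerayHirsch.Idx (fun J : (Σ j, Fin (r j)) => (J.1 : ℕ)) (2 * 2), (J.1.1 : ℕ) = 1 →
      θ.symm cB J = 0 := by
    intro J hJ
    rw [hcB, wordEval_apply, hθsum, Finset.sum_apply]
    refine Finset.sum_eq_zero fun w _ => ?_
    rw [hθsmul, Pi.smul_apply]
    by_cases hw : BAL w
    · by_cases hne : a w = 0
      · simp only [haB, if_pos hw, hne, zero_smul]
      · obtain ⟨m, r', hmr, u, v, s, hFw, -, hr'⟩ := hterm w
        have h1 : r' ≠ 1 := by rw [hr']; exact hdegB w hw hne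
        rw [hFw, hθsmul, Pi.smul_apply, hvan m r' hmr u v J (by rw [hJ]; exact Ne.symm h1), smul_zero, smul_zero]
    · simp only [haB, if_neg hw, zero_smul]
  -- `θ⁻¹ c_W` is the `S`-degree-`1` truncation of `θ⁻¹ c`, whose entries are rational
  set a₁ : LerayHirsch.Src ℂ (fun J : (Σ j, Fin (r j)) => (J.1 : ℕ)) (Motives.ComplexPoints Y.X) (2 * 2) :=
    fun J => if (J.1.1 : ℕ) = 1 then θ.symm c J else 0 with ha₁
  have hθcW : θ.symm cW = a₁ := by
    funext J
    by_cases hJ : (J.1.1 : ℕ) = 1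
    · rw [ha₁]; simp only [if_pos hJ]
      rw [hc_eq, hθadd, Pi.add_apply, hθB J hJ, zero_add]
    · rw [ha₁]; simp only [if_neg hJ]
      exact hθW J hJ
  have hcW_eq : cW = θ a₁ := by rw [← hθcW, LinearEquiv.apply_symm_apply]
  have hcWQ : IsRationalClass cW := by
    rw [hcW_eq, hθ, LinearEquiv.ofBijective_apply, LerayHirsch.lhMap_apply]
    refine isRationalClass_sum _ _ fun J _ => ?_
    split_ifs with hJk
    · refine (IsRationalClass.map _ ?_).cup _ ((hbQ J.1 J.2).map _)
      rw [ha₁]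
      dsimp only
      split_ifs with hJ1
      · exact isRationalClass_kunneth_symm_apply hYs hSs b hbQ (2 * 2) hcQ ⟨J, hJk⟩
      · exact IsRationalClass.zero
    · exact IsRationalClass.zero
  have hcBQ : IsRationalClass cB := by
    have e : cB = c - cW := by rw [hc_eq, add_sub_cancel_right]
    rw [e]; exact hcQ.sub hcWQ
  -- (4) `c_W = Σ_a α_a^*(σ_a^* c_W)` with `α_a = 𝟙 × q_a`, `σ_a = 𝟙 × i_a`, `Σ_a q_a ≫ i_a = 𝟙`
  set P := Motives.AbelianVariety.fst (E.prod E) E with hP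
  set Q := Motives.AbelianVariety.snd (E.prod E) E with hQ
  set I' := HOneProduct.inlHom (E.prod E) E with hI'
  set J' := HOneProduct.inrHom (E.prod E) E with hJ'
  set p₁ := Motives.AbelianVariety.fst E E with hp₁
  set p₂ := Motives.AbelianVariety.snd E E with hp₂
  set i₁ := HOneProduct.inlHom E E with hi₁
  set i₂ := HOneProduct.inrHom E E with hi₂
  set q₁ : (E.prod E).prod E ⟶ E := P ≫ p₁ with hq₁
  set q₂ : (E.prod E).prod E ⟶ E := P ≫ p₂ with hq₂
  set q₃ : (E.prod E).prod E ⟶ E := Q with hq₃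
  set j₁ : E ⟶ (E.prod E).prod E := i₁ ≫ I' with hj₁
  set j₂ : E ⟶ (E.prod E).prod E := i₂ ≫ I' with hj₂
  set j₃ : E ⟶ (E.prod E).prod E := J' with hj₃
  have he : q₁ ≫ j₁ + q₂ ≫ j₂ + q₃ ≫ j₃ = 𝟙 ((E.prod E).prod E) := by
    have hin : p₁ ≫ i₁ + p₂ ≫ i₂ = 𝟙 (E.prod E) := HOneProduct.fst_inlHom_add_snd_inrHom E E
    have hout : P ≫ I' + Q ≫ J' = 𝟙 ((E.prod E).prod E) := HOneProduct.fst_inlHom_add_snd_inrHom (E.prod E) E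
    have h1 : q₁ ≫ j₁ + q₂ ≫ j₂ = P ≫ I' := by
      rw [hq₁, hq₂, hj₁, hj₂, Category.assoc, Category.assoc, ← Category.assoc p₁, ← Category.assoc p₂,
        ← Preadditive.comp_add, ← Preadditive.add_comp, hin, Category.id_comp]
    rw [h1, hq₃, hj₃, hout]
  have hθf : ∀ (q : (E.prod E).prod E ⟶ E) (i : E ⟶ (E.prod E).prod E),
      (Motives.AbelianVariety.prodMap (𝟙 Y) q ≫ Motives.AbelianVariety.prodMap (𝟙 Y) i) ≫
        Motives.AbelianVariety.fst Y ((E.prod E).prod E) = Motives.AbelianVariety.fst Y ((E.prod E).prod E) := by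
    intro q i
    rw [Category.assoc, Motives.AbelianVariety.prodMap_fst, ← Category.assoc, Motives.AbelianVariety.prodMap_fst,
      Category.comp_id, Category.comp_id]
  have hθs : ∀ (q : (E.prod E).prod E ⟶ E) (i : E ⟶ (E.prod E).prod E),
      (Motives.AbelianVariety.prodMap (𝟙 Y) q ≫ Motives.AbelianVariety.prodMap (𝟙 Y) i) ≫
        Motives.AbelianVariety.snd Y ((E.prod E).prod E) = Motives.AbelianVariety.snd Y ((E.prod E).prod E) ≫ (q ≫ i) := by
    intro q i
    rw [Category.assoc, Motives.AbelianVariety.prodMap_snd, ← Category.assoc, Motives.AbelianVariety.prodMap_snd,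
      Category.assoc]
  set α₁ : Y.prod ((E.prod E).prod E) ⟶ Y.prod E := Motives.AbelianVariety.prodMap (𝟙 Y) q₁ with hα₁
  set α₂ : Y.prod ((E.prod E).prod E) ⟶ Y.prod E := Motives.AbelianVariety.prodMap (𝟙 Y) q₂ with hα₂
  set α₃ : Y.prod ((E.prod E).prod E) ⟶ Y.prod E := Motives.AbelianVariety.prodMap (𝟙 Y) q₃ with hα₃
  set σ₁ : Y.prod E ⟶ Y.prod ((E.prod E).prod E) := Motives.AbelianVariety.prodMap (𝟙 Y) j₁ with hσ₁
  set σ₂ : Y.prod E ⟶ Y.prod ((E.prod E).prod E) := Motives.AbelianVariety.prodMap (𝟙 Y) j₂ with hσ₂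
  set σ₃ : Y.prod E ⟶ Y.prod ((E.prod E).prod E) := Motives.AbelianVariety.prodMap (𝟙 Y) j₃ with hσ₃
  -- the linear map `θ₁^* + θ₂^* + θ₃^*` fixes `c_W`
  set Φ : complexBetti (Y.prod ((E.prod E).prod E)).X (2 * 2) →ₗ[ℂ] complexBetti (Y.prod ((E.prod E).prod E)).X (2 * 2) :=
    (complexBetti.map (α₁ ≫ σ₁).hom.hom.hom (2 * 2)).hom + (complexBetti.map (α₂ ≫ σ₂).hom.hom.hom (2 * 2)).hom +
      (complexBetti.map (α₃ ≫ σ₃).hom.hom.hom (2 * 2)).hom with hΦ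
  have hΦapply : ∀ x, Φ x = complexBetti.map (α₁ ≫ σ₁).hom.hom.hom (2 * 2) x +
      complexBetti.map (α₂ ≫ σ₂).hom.hom.hom (2 * 2) x + complexBetti.map (α₃ ≫ σ₃).hom.hom.hom (2 * 2) x := fun x => rfl
  have hΦmono : ∀ w : Fin (2 * 2) → (Fin 1 × (Fin hA ⊕ Fin h)) × Fin 2, ¬ BAL w → a w ≠ 0 →
      Φ (F (L ∘ w)) = F (L ∘ w) := by
    intro w hw hne
    obtain ⟨m, r', hmr, u, v, s, hFw, -, hr'⟩ := hterm w
    have h1 : r' = 1 := by rw [hr']; exact hdegW w hw hne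
    subst h1
    rw [hFw, map_smul, hΦapply, map_add_map_add_map_cupProduct_fst_snd_one_cu (hθf q₁ j₁) (hθs q₁ j₁) (hθf q₂ j₂)
      (hθs q₂ j₂) (hθf q₃ j₃) (hθs q₃ j₃) he hmr u v]
  have hΦcW : Φ cW = cW := by
    rw [hcW, wordEval_apply, map_sum]
    refine Finset.sum_congr rfl fun w _ => ?_
    rw [map_smul]
    by_cases hw : BAL w
    · simp only [haW, if_pos hw, zero_smul]
    · by_cases hne : a w = 0
      · simp only [haW, if_neg hw, hne, zero_smul]
      · rw [hΦmono w hw hne]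
  have hcW_pull : cW = complexBetti.map α₁.hom.hom.hom (2 * 2) (complexBetti.map σ₁.hom.hom.hom (2 * 2) cW) +
      complexBetti.map α₂.hom.hom.hom (2 * 2) (complexBetti.map σ₂.hom.hom.hom (2 * 2) cW) +
      complexBetti.map α₃.hom.hom.hom (2 * 2) (complexBetti.map σ₃.hom.hom.hom (2 * 2) cW) := by
    rw [← Milne1999.complexBetti_map_comp_apply, ← Milne1999.complexBetti_map_comp_apply,
      ← Milne1999.complexBetti_map_comp_apply, ← hΦapply, hΦcW]
  -- (5) conclusion: `c_B ∈ D²`, `c_W ∈ Σ_a α_a^* B²(T × E)`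
  rw [hc_eq]
  refine Submodule.add_mem_sup ?_ ?_
  · have hcB22' : IsOfHodgeType (Y.dim + ((E.prod E).prod E).dim) (Y.X ⊗ ((E.prod E).prod E).X) (2 * 2) 2 2 cB := by
      rw [← Motives.AbelianVariety.dim_prod]; exact hcB22
    have hspan := mem_span_hodgeProductClasses_of_mem_span_pureType Y ((E.prod E).prod E) hcBQ hcB22'
      (Submodule.span_mono ?_ hcB_mem)
    swap
    · rintro z ⟨i, j, hij, dd, μ, hdd, hμ, rfl⟩
      exact ⟨i, j, hij, dd, μ, hdd, hμ, rfl⟩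
    rw [Motives.AbelianVariety.dim_prod]
    exact Submodule.span_le.2 (hodgeProductClasses_subset_divisorClassesSpan Y ((E.prod E).prod E)
      (isDivisorGenerated_of_dim_le_three Y (by omega)) (isDivisorGenerated_of_dim_le_three ((E.prod E).prod E) (by omega)) 2)
      hspan
  · rw [hcW_pull]
    refine Submodule.add_mem _ (Submodule.add_mem _ ?_ ?_) ?_
    · exact Submodule.subset_span ⟨q₁, _, Or.inl rfl, hcWQ.map _, hcW22.map_of_isSmoothProjective hXE hXP _, rfl⟩
    · exact Submodule.subset_span ⟨q₂, _, Or.inr (Or.inl rfl), hcWQ.map _, hcW22.map_of_isSmoothProjective hXE hXP _, rfl⟩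
    · exact Submodule.subset_span ⟨q₃, _, Or.inr (Or.inr rfl), hcWQ.map _, hcW22.map_of_isSmoothProjective hXE hXP _, rfl⟩

end CodimTwo

end Literature.AlgebraicGeometry.HodgeTheory

end
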